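import Summits.NavierStokesRegularity.NavierStokesRegularity.Theorems.NoOverheating.Negative.ExcludedStrataCensusV16
import Summits.NavierStokesRegularity.NavierStokesRegularity.Theorems.NoOverheating.Negative.ParityOddWindowsExcluded

/-!
# KJ-71b — CENSUS v17 of the excluded strata of route `AngularGalerkinLadder`'s window sequences
# ((S0)–(S30) of `excludedStrata_windowSequences_v16` + the PARITY strata of circuit g12's
# `ParityOddWindowsExcluded` (p574133): (S31) asymptotically σ-odd for SOME linear isometry σ,
# (S31a) asymptotically EVEN)

Refuter lineage, Negative lane of crux K2 `NoOverheating` (supports, does not decide).  Pure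
assembly — this file proves NOTHING new: it folds the ACCEPTED kernel file
`ParityOddWindowsExcluded` (seat `ns-blowup-circuit` g12, INSTRUMENT for 19960) into the census
statement of record, `excludedStrata_windowSequences_v17`, "what an admissible window sequence of
K2 can NOT be":

* (S31) for some linear isometry `σ` of `ℝ³`, `σ uₙ(t, σ⁻¹x) + uₙ(t, x) → 0` pointwise on `t < 0`
  (`…ParityOddWindowsExcluded.no_windowSequence_asymptoticallyParityOdd_census`: the ladder limit
  is a σ-odd Type-I ancient mild solution; `v` and `−v = σ̂v` both solve the Oseen–Duhamel
  identity, so the BILINEAR term `B_s(v,v)` vanishes, `v` is caloric from every past time and the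
  Type-I rate `C/√(−s) → 0` kills it — against the inherited floor `δ`).  The exactly σ-odd case
  (constant sequence of defects `0`) is contained.
* (S31a) the instance `σ = −1`: `uₙ(t, x) − uₙ(t, −x) → 0` pointwise on `t < 0` — asymptotically
  EVEN window sequences (`…no_windowSequence_asymptoticallyEven_census`).

Numbering note: circuit g12's STATUS line l.10818 proposed these as "(S28)/(S28a)"; (S28) is taken
(rotating waves, KJ-68 `RotatingWaveProfilesExcluded`), so the parity strata enter as (S31)/(S31a).

Census sentence after v17: as v16, AND (parity) no admissible window sequence is asymptotically
odd under ANY linear isometry σ (σ-conjugate plus identity → 0) — in particular not asymptotically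
even; next to (S18)–(S21) (asymptotic axisymmetry / screw slice norm / steadiness / vanishing-angle
rotation invariance) the symmetry-DEFECT clauses now cover the sign-reversing symmetries as well.
[cite: KochNadirashviliSereginSverak2009, Lemma 6.1 (limits of rescaled solutions)] -/

namespace Summit.NavierStokesRegularity.AngularGalerkinLadderExcludedStrataCensusV17

open Set Filter MeasureTheory Topology Function
open scoped ENNReal
open Literature.Analysis Literature.Analysis.FluidPDE
open Summit.NavierStokesRegularity.FluidComputer
open Summit.NavierStokesRegularity.NavierStokesRegularity.Theses.AngularGalerkinLadder
open Summit.NavierStokesRegularity.AngularGalerkinLadderExcludedStrataCensusV16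
open Summit.NavierStokesRegularity.AngularGalerkinLadderParityOddWindowsExcluded

/-- **Census theorem v17: the excluded strata (S0)–(S31a) of K2's window sequences.**  As
`excludedStrata_windowSequences_v16`, plus the parity strata: (S31) asymptotically `σ`-odd for some
linear isometry `σ` (`σ uₙ(t, σ⁻¹x) + uₙ(t, x) → 0` pointwise on `t < 0`), (S31a) asymptotically
even (`uₙ(t, x) − uₙ(t, −x) → 0`) — for ANY `C₀`, ANY window and ANY rotations.
[cite: KochNadirashviliSereginSverak2009, Lemma 6.1 (limits of rescaled solutions)] -/
theorem excludedStrata_windowSequences_v17 :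
    ∃ ε₀ : ℝ, 0 < ε₀ ∧ ∀ C₀ : ℝ, ∃ κ α₁ c₁ α₂ c₂ lam₁ β₁ β₂ lam₂ : ℝ,
      1 < κ ∧ 0 < α₁ ∧ 1 < c₁ ∧ 0 < α₂ ∧ 1 < c₂ ∧ 1 < lam₁ ∧ 0 < β₁ ∧ 0 < β₂ ∧ 1 < lam₂ ∧
      ∀ {cmin cmax δ : ℝ} {L : ℕ → ℕ} {ε c : ℕ → ℝ}
        {R : ℕ → (EuclideanSpace ℝ (Fin 3) ≃ₗᵢ[ℝ] EuclideanSpace ℝ (Fin 3))}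
        {u : ℕ → ℝ → EuclideanSpace ℝ (Fin 3) → EuclideanSpace ℝ (Fin 3)}
        {p : ℕ → ℝ → EuclideanSpace ℝ (Fin 3) → ℝ}
        {d : ℕ → ℝ → EuclideanSpace ℝ (Fin 3) → EuclideanSpace ℝ (Fin 3)},
        1 < cmin → 0 < δ → Tendsto ε atTop (𝓝 0) →
        (∀ n, AngularLadder.IsWindowProfile (L n) C₀ cmin cmax δ (ε n) (c n) (R n) (u n) (p n)
          (d n)) →
        ¬ (C₀ ≤ ε₀ ∨
           (∀ n, ∀ t < 0, IsAxisymmetric (u n t)) ∨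
           (∃ q : ℕ, 0 < q ∧ cmax ^ q < κ ∧
              ∀ x, Tendsto (fun n => ((R n) ^ q) x) atTop (𝓝 x)) ∨
           (∃ (q : ℕ) (g : ℕ → (EuclideanSpace ℝ (Fin 3) ≃ₗᵢ[ℝ] EuclideanSpace ℝ (Fin 3)))
              (θ : ℕ → ℝ),
              0 < q ∧ cmax ^ q < c₁ ∧ (∀ n x, ((R n) ^ q) x = g n (rotZ (θ n) ((g n).symm x))) ∧
              ∀ n, |θ n| ≤ 2 * α₁ * (q * Real.log (c n))) ∨
           (∃ (Θ ℓ : ℝ) (g : ℕ → (EuclideanSpace ℝ (Fin 3) ≃ₗᵢ[ℝ] EuclideanSpace ℝ (Fin 3)))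
              (θ : ℕ → ℝ),
              ℓ < Real.log c₂ ∧ (∀ n x, R n x = g n (rotZ (θ n) ((g n).symm x))) ∧
              (∀ n, |θ n| ≤ Θ) ∧ (∀ n, 2 * α₂ * Real.log (c n) ≤ |θ n|) ∧
              ∀ n, (1 + (θ n / (2 * Real.log (c n))) ^ 2) * Real.log (c n) ≤ ℓ) ∨
           (∃ lam : ℝ, 1 < lam ∧ lam < lam₁ ∧ ∀ n, IsDiscretelySelfSimilar lam (u n)) ∨
           (∀ n, IsSelfSimilar (u n)) ∨
           (∃ (g : ℕ → (EuclideanSpace ℝ (Fin 3) ≃ₗᵢ[ℝ] EuclideanSpace ℝ (Fin 3))) (α : ℕ → ℝ),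
              (∀ n (μ : ℝ), 1 < μ → IsRotatedDSS μ
                (((g n).symm.trans (rotZLIE (2 * α n * Real.log μ))).trans (g n)) (u n)) ∧
              ∀ n, |α n| ≤ β₁ ∨ β₂ ≤ |α n|) ∨
           (∃ M : ℝ≥0∞, M < ⊤ ∧ ∀ n, eLpNorm (u n (-1)) 3 volume ≤ M) ∨
           (∃ M : ℝ≥0∞, M < ⊤ ∧ ∀ n, eLpNorm (u n (-1)) 2 volume ≤ M) ∨
           (∀ η : ℝ, 0 < η → ∃ ρ : ℝ, ∀ n x, ρ ≤ ‖x‖ → ‖x‖ * ‖u n (-1) x‖ ≤ η) ∨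
           (∀ n, ∀ t < 0, ∃ e : EuclideanSpace ℝ (Fin 3), ∀ x,
              curl (u n t) x = ‖curl (u n t) x‖ • e) ∨
           (∀ n, ∃ (d₀ : ℝ) (η : ℝ → ℝ), Tendsto η (𝓝[>] 0) (𝓝 0) ∧
              ∀ s ∈ Ioo (-1 : ℝ) 0, ∀ x y, d₀ < ‖curl (u n s) x‖ → d₀ < ‖curl (u n s) y‖ →
                ‖vorticityDirection (curl (u n s)) x - vorticityDirection (curl (u n s)) y‖ ≤
                  η ‖x - y‖) ∨
           (∃ (n : ℕ) (S : EuclideanSpace ℝ (Fin 3) ≃ₗᵢ[ℝ] EuclideanSpace ℝ (Fin 3))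
              (b : EuclideanSpace ℝ (Fin 3)), S b = b ∧ b ≠ 0 ∧
              ∀ x, ‖u n (-1) (S x + b)‖ = ‖u n (-1) x‖) ∨
           (∃ (n : ℕ) (ρ B : ℝ), 0 < ρ ∧
              ∀ z ∈ parabolicCylinder ρ (0 : ℝ × EuclideanSpace ℝ (Fin 3)), ‖u n z.1 z.2‖ ≤ B) ∨
           (∃ (n : ℕ) (U : EuclideanSpace ℝ (Fin 3) → EuclideanSpace ℝ (Fin 3)),
              Continuous U ∧ ∀ t < 0, u n t = U) ∨
           (∃ (n : ℕ) (e : EuclideanSpace ℝ (Fin 3)), ∀ x, ∃ a : ℝ,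
              curl (u n (-1)) x = a • e) ∨
           (∃ (n : ℕ) (d₀ : ℝ) (η : ℝ → ℝ), Tendsto η (𝓝[>] 0) (𝓝 0) ∧
              ∀ s ∈ Ioo (-1 : ℝ) 0, ∀ x y, d₀ < ‖curl (u n s) x‖ → d₀ < ‖curl (u n s) y‖ →
                min ‖vorticityDirection (curl (u n s)) x - vorticityDirection (curl (u n s)) y‖
                    ‖vorticityDirection (curl (u n s)) x + vorticityDirection (curl (u n s)) y‖ ≤
                  η ‖x - y‖) ∨
           (∃ (n : ℕ) (ρ M : ℝ), 0 < ρ ∧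
              ∀ z ∈ parabolicCylinder ρ (0 : ℝ × EuclideanSpace ℝ (Fin 3)),
                ‖curl (u n z.1) z.2‖ ≤ M) ∨
           (∃ (n : ℕ) (e : EuclideanSpace ℝ (Fin 3)) (ρ M : ℝ), (R n e = e ∨ R n e = -e) ∧
              0 < ρ ∧ ∀ z ∈ parabolicCylinder ρ (0 : ℝ × EuclideanSpace ℝ (Fin 3)),
                ∃ a : ℝ, ‖u n z.1 z.2 - a • e‖ ≤ M) ∨
           (∃ (n : ℕ) (e : EuclideanSpace ℝ (Fin 3)) (ρ M : ℝ), (R n e = e ∨ R n e = -e) ∧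
              0 < ρ ∧ ∀ z ∈ parabolicCylinder ρ (0 : ℝ × EuclideanSpace ℝ (Fin 3)),
                ∃ a : ℝ, ‖curl (u n z.1) z.2 - a • e‖ ≤ M) ∨
           (∃ (n : ℕ) (S : EuclideanSpace ℝ (Fin 3) ≃ₗᵢ[ℝ] EuclideanSpace ℝ (Fin 3))
              (b : EuclideanSpace ℝ (Fin 3)), S b = b ∧ b ≠ 0 ∧
              ∀ x, ‖u n (-1) x‖ ≤ ‖u n (-1) (S x + b)‖) ∨
           (∃ A : ℕ → (EuclideanSpace ℝ (Fin 3) ≃ₗᵢ[ℝ] EuclideanSpace ℝ (Fin 3)),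
              ∀ θ, ∀ t < 0, ∀ x,
                Tendsto (fun n => (A n).symm (u n t (A n (rotZ θ x))) -
                  rotZ θ ((A n).symm (u n t (A n x)))) atTop (𝓝 0)) ∨
           (∃ (S : EuclideanSpace ℝ (Fin 3) ≃ₗᵢ[ℝ] EuclideanSpace ℝ (Fin 3))
              (b : EuclideanSpace ℝ (Fin 3)), S b = b ∧ b ≠ 0 ∧
              ∀ x, Tendsto (fun n => ‖u n (-1) (S x + b)‖ - ‖u n (-1) x‖) atTop (𝓝 0)) ∨
           (∀ s < 0, ∀ t < 0, ∀ x, Tendsto (fun n => u n t x - u n s x) atTop (𝓝 0)) ∨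
           (∃ (A : ℕ → (EuclideanSpace ℝ (Fin 3) ≃ₗᵢ[ℝ] EuclideanSpace ℝ (Fin 3))) (α : ℕ → ℝ),
              Tendsto α atTop (𝓝 0) ∧ (∀ n, α n ≠ 0) ∧ ∀ n, ∀ t < 0, ∀ x,
                (A n).symm (u n t (A n (rotZ (α n) x))) =
                  rotZ (α n) ((A n).symm (u n t (A n x)))) ∨
           (∃ σ : ℕ → ℝ, (∀ n, 1 < σ n) ∧ Tendsto σ atTop (𝓝 1) ∧
              ∀ n, IsDiscretelySelfSimilar (σ n) (u n)) ∨
           (∃ lam : ℝ, 1 < lam ∧ lam < lam₂ ∧ ∀ t < 0, ∀ x,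
              Tendsto (fun n => lam • u n (lam ^ 2 * t) (lam • x) - u n t x) atTop (𝓝 0)) ∨
           (∃ (n : ℕ) (τ : ℝ), 0 < τ ∧ ∀ t < 0, ∀ x, u n (t - τ) x = u n t x) ∨
           (∃ (τ : ℕ → ℝ) (τ₀ : ℝ), 0 < τ₀ ∧ Tendsto τ atTop (𝓝 τ₀) ∧
              ∀ t < 0, ∀ x, Tendsto (fun n => u n (t - τ n) x - u n t x) atTop (𝓝 0)) ∨
           (∃ (n : ℕ) (U : EuclideanSpace ℝ (Fin 3) → EuclideanSpace ℝ (Fin 3))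
              (b : EuclideanSpace ℝ (Fin 3)), ∀ t < 0, ∀ x, u n t x = U (x - t • b)) ∨
           (∃ b : EuclideanSpace ℝ (Fin 3), ∀ s < 0, ∀ t < 0, ∀ x,
              Tendsto (fun n => u n t (x + t • b) - u n s (x + s • b)) atTop (𝓝 0)) ∨
           (∃ n : ℕ, ∀ lam : ℝ, 0 < lam → lam < 1 → ∀ x,
              lam • u n (-1) (lam • x) = u n (-1) x) ∨
           (∀ lam : ℝ, 0 < lam → lam < 1 → ∀ x,
              Tendsto (fun n => lam • u n (-1) (lam • x) - u n (-1) x) atTop (𝓝 0)) ∨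
           (∃ (n : ℕ) (g : ℝ → (EuclideanSpace ℝ (Fin 3) ≃ₗᵢ[ℝ] EuclideanSpace ℝ (Fin 3))),
              ∀ s < 0, ∀ t < 0, ∀ x, ‖u n s (g s x)‖ = ‖u n t (g t x)‖) ∨
           (∃ g : ℝ → (EuclideanSpace ℝ (Fin 3) ≃ₗᵢ[ℝ] EuclideanSpace ℝ (Fin 3)),
              ∀ s < 0, ∀ t < 0, ∀ x,
                Tendsto (fun n => ‖u n s (g s x)‖ - ‖u n t (g t x)‖) atTop (𝓝 0)) ∨
           (∃ (n : ℕ) (lam : ℝ), 0 < lam ∧ lam < 1 ∧ ∀ x,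
              lam • u n (-1) (lam • x) = u n (-1) x) ∨
           (∃ lam : ℝ, 0 < lam ∧ lam < 1 ∧ ∀ x,
              Tendsto (fun n => lam • u n (-1) (lam • x) - u n (-1) x) atTop (𝓝 0)) ∨
           (∃ (n : ℕ) (lam μ : ℝ), 0 < lam ∧ lam < 1 ∧ ∀ x,
              μ • u n (-1) (lam • x) = u n (-1) x) ∨
           (∃ lam μ : ℝ, 0 < lam ∧ lam < 1 ∧ ∀ x,
              Tendsto (fun n => μ • u n (-1) (lam • x) - u n (-1) x) atTop (𝓝 0)) ∨
           (∃ σ : EuclideanSpace ℝ (Fin 3) ≃ₗᵢ[ℝ] EuclideanSpace ℝ (Fin 3),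
              ∀ t < 0, ∀ x, Tendsto (fun n => σ (u n t (σ.symm x)) + u n t x) atTop (𝓝 0)) ∨
           (∀ t < 0, ∀ x, Tendsto (fun n => u n t x - u n t (-x)) atTop (𝓝 0))) := by
  obtain ⟨ε₀, hε₀, H⟩ := excludedStrata_windowSequences_v16
  refine ⟨ε₀, hε₀, fun C₀ => ?_⟩
  obtain ⟨κ, α₁, c₁, α₂, c₂, lam₁, β₁, β₂, lam₂, hκ, hα₁, hc₁, hα₂, hc₂, hlam₁, hβ₁, hβ₂, hlam₂,
    HC⟩ := H C₀
  refine ⟨κ, α₁, c₁, α₂, c₂, lam₁, β₁, β₂, lam₂, hκ, hα₁, hc₁, hα₂, hc₂, hlam₁, hβ₁, hβ₂, hlam₂,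
    fun {cmin cmax δ L ε c R u p d} hcmin hδ hε hW => ?_⟩
  have HC' := HC hcmin hδ hε hW
  simp only [not_or] at HC' ⊢
  obtain ⟨h0, h1, h2, h3, h4, h5, h6, h7, h8, h9, h10, h11, h12, h13, h14, h15, h16, h17, h18, h19,
    h20, h21, h22, h23, h24, h25, h26, h27, h28, h29, h30, h31, h32, h33, h34, h35, h36, h37, h38,
    h39⟩ := HC'
  exact ⟨h0, h1, h2, h3, h4, h5, h6, h7, h8, h9, h10, h11, h12, h13, h14, h15, h16, h17, h18, h19,
    h20, h21, h22, h23, h24, h25, h26, h27, h28, h29, h30, h31, h32, h33, h34, h35, h36, h37, h38,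
    h39, no_windowSequence_asymptoticallyParityOdd_census hcmin hδ hε hW,
    no_windowSequence_asymptoticallyEven_census hcmin hδ hε hW⟩

end Summit.NavierStokesRegularity.AngularGalerkinLadderExcludedStrataCensusV17
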